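import Summits.CriticalPhenomena.CardyFormulaZ2.Theorems.CardyAnchoredRigiditySubseqCardyRectDuality

/-!
# The strip exponent sandwich pins the exponent as a limit, uniquely
# (crux `SubseqCardy`, stmt-CriticalPhenomena-5768, line `registered`: kernel facts IV, parts 4a/4b)

Route `CardyAnchoredRigidity` (decl shared with `CardyLocalRigidity`), sub-problem `CardyFormulaZ2`.
For a joint sequential limit `g` of the bond-`ℤ²` crossing probabilities the lead proves a STRIP
EXPONENT SANDWICH: some `l` with, for every `w > 0` and every box `L_w` (carrier `(0,w) × (0,1)`,
arc `0` = left side `{re = 0, im ∈ [0,1]}`, arc `2` = right side `{re = w, im ∈ [0,1]}`),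

  `exp (-(l w)) ≤ g L_w ≤ 2 exp (l (1 - w))`.

This file records the two PURE consequences of such a sandwich (no percolation input beyond the
existence of a marked box of every width, `JointLimit.exists_lrBox`):

* `stripSandwich_tendsto` (part 4a): along ANY choice of boxes `w ↦ L w` the normalised logarithms
  `-log (g (L w)) / w` tend to `l` as `w → ∞`;
* `stripSandwich_unique` (part 4b): hence the exponent `l` of a sandwich is unique.

Proof. At one box of width `w > 0` the sandwich gives `g (L w) ≥ exp (-(l w)) > 0`, so
`-log (g (L w)) / w ≤ l`, and `log (g (L w)) ≤ log 2 + l (1 - w)`, so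
`-log (g (L w)) / w ≥ l - (l + log 2) / w` (`StripExponent.sandwich_bounds`). Squeeze between
`l - (l + log 2) / w → l` and the constant `l`. Uniqueness: pick boxes of every width
(`exists_lrBox`), apply part 4a to `l` and to `l'`, and limits in `ℝ` are unique.

References: B. Bollobás, O. Riordan, *Percolation* (2006), Ch. 3 (exponential decay of long
crossings); elementary real analysis (Fekete-type normalisation).
-/

noncomputable section

namespace Summit.CriticalPhenomena.CardyFormulaZ2.Cruxes.SubseqCardy.Birth

open Set Filter Topology
open Literature.Probability.RandomPlanarGeometry (ConformalRectangle)

namespace StripExponent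

/-- **The two-sided bound at one box.** If `exp (-(l w)) ≤ x ≤ 2 exp (l (1 - w))` with `w > 0`,
then `l - (l + log 2) / w ≤ -log x / w ≤ l`. [folklore] -/
theorem sandwich_bounds {x l w : ℝ} (hw : 0 < w) (h1 : Real.exp (-(l * w)) ≤ x)
    (h2 : x ≤ 2 * Real.exp (l * (1 - w))) :
    l - (l + Real.log 2) / w ≤ -Real.log x / w ∧ -Real.log x / w ≤ l := by
  have hx : 0 < x := (Real.exp_pos _).trans_le h1
  constructor
  · have hlog : Real.log x ≤ Real.log 2 + l * (1 - w) := by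
      have h2' : Real.log x ≤ Real.log (2 * Real.exp (l * (1 - w))) := Real.log_le_log hx h2
      rwa [Real.log_mul two_ne_zero (Real.exp_pos _).ne', Real.log_exp] at h2'
    rw [le_div_iff₀ hw, sub_mul, div_mul_cancel₀ _ hw.ne']
    linarith
  · have hlog : -(l * w) ≤ Real.log x := (Real.le_log_iff_exp_le hx).2 h1
    rw [div_le_iff₀ hw]
    linarith

/-- The lower envelope `w ↦ l - (l + log 2) / w` tends to `l` as `w → ∞`. [folklore] -/
theorem tendsto_lowerEnvelope (l : ℝ) :
    Tendsto (fun w : ℝ => l - (l + Real.log 2) / w) atTop (𝓝 l) := by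
  simpa using (tendsto_const_nhds (x := l)).sub
    ((tendsto_const_nhds (x := l + Real.log 2)).div_atTop tendsto_id)

/-- **Part 4a, working form.** A sandwich `exp (-(l w)) ≤ g (L w) ≤ 2 exp (l (1 - w))` for all
`w > 0` forces `-log (g (L w)) / w → l` as `w → ∞`. [folklore] -/
theorem tendsto_of_sandwich {g : ConformalRectangle → ℝ} {l : ℝ}
    {L : ℝ → ConformalRectangle}
    (h : ∀ w : ℝ, 0 < w →
      Real.exp (-(l * w)) ≤ g (L w) ∧ g (L w) ≤ 2 * Real.exp (l * (1 - w))) :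
    Tendsto (fun w : ℝ => -Real.log (g (L w)) / w) atTop (𝓝 l) := by
  refine tendsto_of_tendsto_of_tendsto_of_le_of_le' (tendsto_lowerEnvelope l) tendsto_const_nhds
    ?_ ?_
  · filter_upwards [eventually_gt_atTop (0:ℝ)] with w hw
    exact (sandwich_bounds hw (h w hw).1 (h w hw).2).1
  · filter_upwards [eventually_gt_atTop (0:ℝ)] with w hw
    exact (sandwich_bounds hw (h w hw).1 (h w hw).2).2

/-- **A choice of marked boxes of every width**: some `L : ℝ → ConformalRectangle` with `L w`
the box `(0,w) × (0,1)`, arc `0` = left side, arc `2` = right side, for every `w > 0`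
(`JointLimit.exists_lrBox` and choice). [folklore] -/
theorem exists_lrBoxes : ∃ L : ℝ → ConformalRectangle, ∀ w : ℝ, 0 < w →
    (L w).carrier = (Ioo (0:ℝ) w ×ℂ Ioo (0:ℝ) 1) ∧
      (L w).arc 0 = {z : ℂ | z.re = 0 ∧ z.im ∈ Icc (0:ℝ) 1} ∧
        (L w).arc 2 = {z : ℂ | z.re = w ∧ z.im ∈ Icc (0:ℝ) 1} := by
  classical
  refine ⟨fun w => if hw : 0 < w then Classical.choose (JointLimit.exists_lrBox w hw)
    else Classical.choose (JointLimit.exists_lrBox 1 one_pos), fun w hw => ?_⟩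
  simp only [dif_pos hw]
  exact Classical.choose_spec (JointLimit.exists_lrBox w hw)

end StripExponent

/-- **Registered sub-goal `stripSandwich_tendsto` (line `registered`, lead c6; kernel facts IV,
part 4a) — the strip exponent sandwich pins the exponent as a limit**: if
`exp (-(l w)) ≤ g L ≤ 2 exp (l (1 - w))` for every `w > 0` and every box `L` of width `w`
(carrier `(0,w) × (0,1)`, arc `0` = left side, arc `2` = right side), then along any choice of
such boxes `w ↦ L w`, `-log (g (L w)) / w → l` as `w → ∞`. [folklore] -/
theorem stripSandwich_tendsto : ∀ (g : Literature.Probability.RandomPlanarGeometry.ConformalRectangle → ℝ) (l : ℝ), (∀ w : ℝ, 0 < w → ∀ L : Literature.Probability.RandomPlanarGeometry.ConformalRectangle, L.carrier = (Set.Ioo (0:ℝ) w ×ℂ Set.Ioo (0:ℝ) 1) → L.arc 0 = {z : ℂ | z.re = 0 ∧ z.im ∈ Set.Icc (0:ℝ) 1} → L.arc 2 = {z : ℂ | z.re = w ∧ z.im ∈ Set.Icc (0:ℝ) 1} → Real.exp (-(l * w)) ≤ g L ∧ g L ≤ 2 * Real.exp (l * (1 - w))) → ∀ L : ℝ → Literature.Probability.RandomPlanarGeometry.ConformalRectangle,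 (∀ w : ℝ, 0 < w → (L w).carrier = (Set.Ioo (0:ℝ) w ×ℂ Set.Ioo (0:ℝ) 1) ∧ (L w).arc 0 = {z : ℂ | z.re = 0 ∧ z.im ∈ Set.Icc (0:ℝ) 1} ∧ (L w).arc 2 = {z : ℂ | z.re = w ∧ z.im ∈ Set.Icc (0:ℝ) 1}) → Filter.Tendsto (fun w : ℝ => -Real.log (g (L w)) / w) Filter.atTop (nhds l) :=
  fun _ _ h L hL => StripExponent.tendsto_of_sandwich fun w hw =>
    h w hw (L w) (hL w hw).1 (hL w hw).2.1 (hL w hw).2.2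

/-- **Registered sub-goal `stripSandwich_unique` (line `registered`, lead c6; kernel facts IV,
part 4b) — the exponent of a strip sandwich is unique**: two exponents `l`, `l'` sandwiching the
same `g` on the boxes `(0,w) × (0,1)` (crossed left-to-right) coincide. [folklore] -/
theorem stripSandwich_unique : ∀ (g : Literature.Probability.RandomPlanarGeometry.ConformalRectangle → ℝ) (l l' : ℝ), (∀ w : ℝ, 0 < w → ∀ L : Literature.Probability.RandomPlanarGeometry.ConformalRectangle, L.carrier = (Set.Ioo (0:ℝ) w ×ℂ Set.Ioo (0:ℝ) 1) → L.arc 0 = {z : ℂ | z.re = 0 ∧ z.im ∈ Set.Icc (0:ℝ) 1} → L.arc 2 = {z : ℂ | z.re = w ∧ z.im ∈ Set.Icc (0:ℝ) 1} → Real.exp (-(l * w)) ≤ g L ∧ g L ≤ 2 * Real.exp (l * (1 - w))) → (∀ w : ℝ, 0 < w → ∀ L : Literature.Probability.RandomPlanarGeometry.ConformalRectangle, L.carrier = (Set.Ioo (0:ℝ) w ×ℂ Set.Ioo (0:ℝ) 1) → L.arc 0 = {z : ℂ | z.re = 0 ∧ z.im ∈ Set.Icc (0:ℝ) 1} → L.arc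 2 = {z : ℂ | z.re = w ∧ z.im ∈ Set.Icc (0:ℝ) 1} → Real.exp (-(l' * w)) ≤ g L ∧ g L ≤ 2 * Real.exp (l' * (1 - w))) → l = l' :=
  fun g _ _ h h' => StripExponent.exists_lrBoxes.elim fun L hL =>
    tendsto_nhds_unique (stripSandwich_tendsto g _ h L hL) (stripSandwich_tendsto g _ h' L hL)

end Summit.CriticalPhenomena.CardyFormulaZ2.Cruxes.SubseqCardy.Birth

end
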